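import Literature.MathematicalPhysics.QuantumFieldTheory.Balaban1983to89.B14Eq364Beta
import Literature.MathematicalPhysics.QuantumFieldTheory.Balaban1983to89.Step
import Literature.MathematicalPhysics.QuantumFieldTheory.Balaban1983to89.B14DomainGeom

/-!
# `Balaban1983to89.B14Eq227LocalizedTerms` — CMP 119 (2.26)–(2.27) p. 259, (2.30) p. 260, (2.40)–(2.41) p. 261: the
# LOCALIZED TERMS of the inductive description WITH THEIR TWO MISSING BODIES — the analyticity clause (ii) («there exists
# an analytic function 𝐄^{(j)}(X, (𝐔,𝐉), z) of the variables (𝐔,𝐉) ∈ U^c_j(X, α_{0,j}, α_{1,j})») typed as holomorphy on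
# the tower's spaces, and the SUMMATION RANGES «X ∋ z, X ∈ 𝐃_j, X ⊂ Λ_j» / «z ∈ Λ_j⁰» / «X ⊂ Λ_j^{∼−1}» /
# «X ∩ Ω_j ≠ ∅, X ∩ Z_j^∼ ≠ ∅» WITH BODY on the ℤᵈ cube carrier of the admissible sequences (2.1)–(2.3)

statement-level skeleton of published theorems with citation tags; proofs where landed; nothing here is a claim
about the Yang–Mills mass gap.

CITATION HEADER (lean-in-tree rule).  Source: T. Bałaban, *Convergent renormalization expansions for lattice gauge
theories*, Commun. Math. Phys. **119**, 243–285 (1988), doi:10.1007/bf01217741 [Balaban1988Convergent] (cell paper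
B14 = «[III]»; held `paper:balaban1988-cmp119-convergent-renormalization`, journal page = PDF page + 242; pp. 259–261
re-read for this file on the x2 renders `…-p017-x2.png`, `…-p018-x2.png`, `…-p019-x2.png`); [I] = T. Bałaban, Commun.
Math. Phys. **109** (1987) 249–301 [Balaban1987RG1], (1.9)–(1.10) pp. 261–262 (render `1987-cmp109-rg-I-small-field-p013/
p014-x2.png`).  Mega-formalization `lit-balaban`, unit `lit-balaban-r11` gen 99 (B14 fold owner), SKELETON rows
**B14.Eq2.26–2.27**, **B14.Eq2.30**, **B14.Eq2.40–2.41** — the three kind-A (inductive-assumption) rows of [III] §2 whose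
no-flip record (owner audit `READING-RULE-AUDIT-B14-g96.md` §A9, agreed by the lead in HEAD WORD Q-B14-98-1) names exactly
two defects: *«analyticity (ii) not in content — typed only as the domain `T.space`, no holomorphy (D-f2.1)»* and *«the
summation range … is the abstract index predicate `admE`/`admR`/`admB : Bool`»*.  This file supplies both bodies; it
modifies nothing (the pre-cell record `Step.LFHyp` stays as it is — the new clause is a companion predicate).

THE PRINTED TEXT (verbatim).  p. 259: *«Let us denote by Λ_j⁰ the set which is obtained by removing one layer of the
MR_j-cubes from Λ_j^{(j)} ⊂ T_1^{(j)}. The following representations hold: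
    𝐄^{(j)}(Λ_j, U_k) = Σ_{z∈Λ_j⁰} 𝐄^{(j)}(Λ_j, U_k, z),   (2.26)      𝐄^{(j)}(Λ_j, U_k, z) = Σ_{X∋z} 𝐄^{(j)}(X, U_k, z),   (2.27)
where the last sum is over localization domains X ∈ 𝐃_j contained in Λ_j, X ⊂ Λ_j. The term 𝐄^{(j)}(X, U_k, z) of the last
sum has the following properties: (i) it depends on U_k restricted to X; (ii) there exists an analytic function
𝐄^{(j)}(X, (𝐔,𝐉), z) of the variables (𝐔,𝐉) ∈ U^c_j(X, α_{0,j}, α_{1,j}), which is an extension of this term, i.e., the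
equality (I.1.9) is satisfied; (iii) the extended function is invariant with respect to the gauge transformations
(I.1.10); (iv) it satisfies the inequality (I.1.18).»*  p. 260: *«𝐑_k(U_k) = Σ_{j=1}^{k} [𝐑^{(j)}(Λ_j, U_k) − 𝐑^{(j)}(Λ_j,
1)].  (2.30)  Each function 𝐑^{(j)}(Λ_j, U_k) has the localized renormalization of the form (I.1.7), but with the
summation over localization domains X ∈ 𝐃_j contained in Λ_j^{∼−1}, X ⊂ Λ_j^{∼−1}, which are unions of the MR_j-cubes in
the lattice T_ξ. Terms of this representation have the properties (i)–(iii) formulated above, after (2.27).»*  p. 261: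
*«Σ_{j=1}^{k} 𝐁^{(j)}(U_k, A, {S_i}),  (2.40)  … 𝐁^{(j)}(U_k, A, {S_i}) = Σ_X 𝐁^{(j)}(X, U_k, A, {S_i∩X}),  (2.41)  where the
sum is over domains X ∈ 𝐃_j such, that X∩Ω_j ≠ ∅, and X∩Z_j^∼ ≠ ∅. The localized term … (ii) it has an extension to an
analytic function on the space Ũ^c_j(X, α̃₀, α̃₁)»*.

WHAT THIS FILE TYPES AND PROVES (0 `sorry`; two structures and ten `def`s, all WITH BODY, + theorems; no named fact).
* §1 **(ii) WITH BODY** — `LFHypAnalytic T c k`: for every scale `1 ≤ j ≤ k`, domain `X`, point `z` and coupling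
  `g ∈ [0, γ]`, the extended term `T.E j X z g : Φ → ℂ` is HOLOMORPHIC (`AnalyticOnNhd ℂ`) on the space
  `T.space j X α_{0,j} α_{1,j}` = U^c_j(X, α_{0,j}, α_{1,j}) with the (2.28) radii; the same for `T.R j X` ((2.30): «the
  properties (i)–(iii) formulated above»); and (2.41)(ii): `φ ↦ T.B j X φ a` holomorphic on `T.spaceB j X` = Ũ^c_j(X, α̃₀,
  α̃₁).  CARRIER READING: the tower's configuration type `Φ` is given a complex normed structure — print's (𝐔,𝐉) are
  `G^c × 𝔤^c`-valued bond functions on `X`, `G^c ⊂ GL(N,ℂ) ⊂ Mat_N(ℂ)` ([I] p. 262), and print's spaces are OPEN (strict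
  inequalities (I.1.11)–(1.14), (2.34)–(2.39)), on which «analytic» = `AnalyticOnNhd`.  (I.1.9), the extension equality
  «𝐄^{(j)}(X, g_{j−1}, U_j) = 𝐄^{(j)}(X, g_{j−1}, U_j, J_j)», is the tower's DEFINITION of the real term as the extension
  AT `T.ofBackground U` = (U_j, J_j(U_j)) (`Step.LFActionData.action23`) — nothing to prove.  API: `mono`, `zero`,
  continuity on the spaces.
* §2 **WHERE PRINT CONSUMES (ii)** (the kernel bounds of (3.50) p. 280 and the per-domain bounds of p. 283, both by Cauchy
  estimates from (ii)+(iv) in the tree — `B14.Eq350KernelCauchy`, `B14Claim283RAnalytic`): composed with any holomorphic chart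
  `ch : E → Φ` mapping a set `s` into the space, the chart functional `T.E j X z g ∘ ch` is holomorphic on `s`
  (`analyticOnNhd_E_chart`, `…_R_chart`, `…_B_chart`) and obeys (iv)/(2.31) there (`norm_E_chart_le`, `norm_R_chart_le`)
  — exactly the hypothesis pair (`hf`, `hS`) of the chart-level files `B14Claim283RAnalytic` / `B14.Eq350KernelCauchy`,
  GIVEN the geometric inclusion `MapsTo ch s (T.space …)`.
* §3 **THE RANGES WITH BODY** on pv02's ℤᵈ cube carrier (`B14DomainGeom`: `Pt d`, `enl`, `innerN`; the admissible sequences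
  `{Ω_j}, {Λ_j}` of (2.1)–(2.3) as in `B14.Eq21Admissible.Adm21` — same carrier and letters; `Z_j = Λ_jᶜ` (2.3)): a `Realisation`
  of the tower's domains and points in `T_ξ` (`pts j X ⊆ ℤᵈ`, `rep j z ∈ ℤᵈ`), `Lambda0` = Λ_j⁰ = `innerN (sM j) 1 (Λ j)`
  («removing one layer of the MR_j-cubes»), and the three index predicates `admE` («z ∈ Λ_j⁰, X ∋ z, X ⊂ Λ_j»), `admR`
  («X ⊂ Λ_j^{∼−1}» = `innerN (sM j) 1`), `admB` («X∩Ω_j ≠ ∅ and X∩Z_j^∼ ≠ ∅», `Z^∼ = enl (sZ j) 1 Z`), with their `iff`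
  lemmas and the set-level consequences print uses tacitly: `Λ_j⁰ ⊆ Λ_j`, `X ⊂ Λ_j^{∼−1} ⇒ X^∼ ⊂ Λ_j`
  (`enl_subset_of_admR`), and — at equal cube sides — the 𝐑- and 𝐁-ranges are DISJOINT (`admB_false_of_admR`: a domain
  inside `Λ_j^{∼−1} = ((Λ_jᶜ)^∼)ᶜ` does not meet `Z_j^∼`).
* §4 **THE DISPLAYS (2.26), (2.27), (2.30)'s localized sum and (2.41) WITH BODY in print's nesting** over these ranges
  (`E227`, `E226`, `RLoc`, `B241`), (2.26) as the `Eq226` predicate of `B14.Eq364Beta` PROVED for them (`eq226_E226`), and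
  their agreement with the pre-cell four-family action `Step.LFActionData.action23`: `Esum_eq` (the 𝐄-summand = Re 𝐄^{(j)}(Λ_j, U)
  − Re 𝐄^{(j)}(Λ_j, 1) with (2.26)∘(2.27) inside, `Finset.sum_comm`), `Rsum_eq` ((2.30) verbatim), `Bsum_eq` ((2.40)–(2.41));
  §5 `realise D` = any action record with its three index predicates replaced by these ranges, and `action23_realise` =
  (2.23) with (2.25)/(2.26)–(2.27)/(2.30)/(2.40)–(2.41) ALL WITH BODY (the smeared Wilson actions themselves are WITH BODY in
  r11 g98's `B14.Eq225Concrete.concrete`, used here through the record fields only).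

HONEST SCOPE.  (1) This is the DEFINITION of predicates/data (the inductive ASSUMPTIONS of Theorem 1, asserted by print at
no particular k here — Theorem 1, row B14.Thm1, asserts them at every k); no analytic fact about Bałaban's actual 𝐄, 𝐑, 𝐁
is claimed.  (2) The cube sides `sM j` (MR_j-cubes), `sZ j` (the ∼ of Z_j^∼) and the realisation maps are PARAMETERS
(print's instance: the MR_j- and M-cube partitions of T_ξ), as in `Adm21`.  (3) The one-carrier instantiation of the tower
(B14-CLOSURE §3 item 3) is not attempted.

## References
* [Balaban1988Convergent] T. Bałaban, Commun. Math. Phys. 119 (1988) 243–285: (2.26)–(2.28) p. 259, (2.30)–(2.31) p. 260,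
  (2.34)–(2.42) p. 261, §3 (3.50) p. 280, p. 283.
* [Balaban1987RG1] T. Bałaban, Commun. Math. Phys. 109 (1987) 249–301: (1.7)–(1.10) pp. 261–262, (1.18) p. 263.
-/

open Set
open scoped BigOperators

namespace Literature.MathematicalPhysics.QuantumFieldTheory.Balaban1983to89.B14.Eq227LocalizedTerms

open Literature.MathematicalPhysics.QuantumFieldTheory.Balaban1983to89
open Step B14DomainGeom Finset

variable {P : Params} {G : Type*} [GaugeGroup G] {Φ 𝒢 𝔄 : Type*}

/-! ## §1  (2.27)(ii) / (2.30) / (2.41)(ii): the analyticity clause WITH BODY -/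

/-- **(ii) p. 259 / p. 260 / p. 261 WITH BODY** — the holomorphy clause of the inductive description, companion of the
pre-cell bounds record `Step.LFHyp` (which types (i), (iii), (iv), (2.31), (2.42) and the spaces but not the word
«analytic», DIVERGENCE D-f2.1): on the scales `j = 1, …, k`,
* `analyticE`: *«there exists an analytic function 𝐄^{(j)}(X, (𝐔,𝐉), z) of the variables (𝐔,𝐉) ∈ U^c_j(X, α_{0,j}, α_{1,j}),
  which is an extension of this term»* — `T.E j X z g` is holomorphic on `T.space j X α_{0,j} α_{1,j}` (radii (2.28)) for
  every coupling `g ∈ [0, γ]` at which `LFHyp.boundE` is demanded;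
* `analyticR`: (2.30) *«Terms of this representation have the properties (i)–(iii) formulated above, after (2.27)»*;
* `analyticB`: (2.41)(ii) *«it has an extension to an analytic function on the space Ũ^c_j(X, α̃₀, α̃₁)»* = `T.spaceB j X`,
  for every value `a` of the (real) fluctuation-field/`S`-data.
`Φ` carries a complex normed structure (print's (𝐔,𝐉): `G^c × 𝔤^c`-valued bond functions, [I] p. 262); print's spaces
are open, on them «analytic» = `AnalyticOnNhd ℂ`. [cite: Balaban1988Convergent, (2.27)(ii) p.259, (2.30) p.260, (2.41)(ii) p.261] -/
structure LFHypAnalytic [NormedAddCommGroup Φ] [NormedSpace ℂ Φ] (T : LFTower P G Φ 𝒢 𝔄) (c : LFConsts)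
    (k : ℕ) : Prop where
  analyticE : ∀ j, 1 ≤ j → j ≤ k → ∀ (X : (T.sys j).Dom) (z : T.Pt j) (g : ℝ), 0 ≤ g → g ≤ c.γ →
    AnalyticOnNhd ℂ (T.E j X z g) (T.space j X (c.alpha0 (T.flow.g j)) (c.alpha1 (T.flow.g j)))
  analyticR : ∀ j, 1 ≤ j → j ≤ k → ∀ (X : (T.sys j).Dom),
    AnalyticOnNhd ℂ (T.R j X) (T.space j X (c.alpha0 (T.flow.g j)) (c.alpha1 (T.flow.g j)))
  analyticB : ∀ j, 1 ≤ j → j ≤ k → ∀ (X : (T.sys j).Dom) (a : 𝔄),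
    AnalyticOnNhd ℂ (fun φ => T.B j X φ a) (T.spaceB j X)

namespace LFHypAnalytic

variable [NormedAddCommGroup Φ] [NormedSpace ℂ Φ] {T : LFTower P G Φ 𝒢 𝔄} {c : LFConsts} {k : ℕ}

/-- The clause on the scales `≤ k` restricts to the scales `≤ j` for `j ≤ k` (the inductive assumptions are cumulative in the
scale index, p. 262 «the expressions with indices j < k are exactly as described above»). [cite: Balaban1988Convergent, §2 p.262] -/
theorem mono (h : LFHypAnalytic T c k) {j : ℕ} (hjk : j ≤ k) : LFHypAnalytic T c j where
  analyticE := fun i h1 hi => h.analyticE i h1 (le_trans hi hjk)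
  analyticR := fun i h1 hi => h.analyticR i h1 (le_trans hi hjk)
  analyticB := fun i h1 hi => h.analyticB i h1 (le_trans hi hjk)

/-- At `k = 0` there are no terms yet (the starting density `ρ₀ = exp[−(1/g₀²)A − E]` of Theorem 1, p. 262): the clause is
vacuous. [cite: Balaban1988Convergent, Thm 1 p.262] -/
theorem zero (T : LFTower P G Φ 𝒢 𝔄) (c : LFConsts) : LFHypAnalytic T c 0 where
  analyticE := fun j h1 hj => absurd hj (by omega)
  analyticR := fun j h1 hj => absurd hj (by omega)
  analyticB := fun j h1 hj => absurd hj (by omega)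

/-- An analytic extension ((2.27)(ii)) is in particular continuous on the space. [cite: Balaban1988Convergent, (2.27)(ii) p.259] -/
theorem continuousOn_E (h : LFHypAnalytic T c k) {j : ℕ} (h1 : 1 ≤ j) (hj : j ≤ k) (X : (T.sys j).Dom) (z : T.Pt j)
    {g : ℝ} (hg0 : 0 ≤ g) (hgγ : g ≤ c.γ) :
    ContinuousOn (T.E j X z g) (T.space j X (c.alpha0 (T.flow.g j)) (c.alpha1 (T.flow.g j))) :=
  (h.analyticE j h1 hj X z g hg0 hgγ).continuousOn

/-- Likewise for the 𝐑-terms ((2.30): «the properties (i)–(iii) formulated above»). [cite: Balaban1988Convergent, (2.30) p.260] -/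
theorem continuousOn_R (h : LFHypAnalytic T c k) {j : ℕ} (h1 : 1 ≤ j) (hj : j ≤ k) (X : (T.sys j).Dom) :
    ContinuousOn (T.R j X) (T.space j X (c.alpha0 (T.flow.g j)) (c.alpha1 (T.flow.g j))) :=
  (h.analyticR j h1 hj X).continuousOn

/-! ## §2  Where print consumes (ii): holomorphic charts into the space ((3.50) p. 280, p. 283) -/

variable {E : Type*} [NormedAddCommGroup E] [NormedSpace ℂ E]

/-- **(ii) in a chart.**  For any holomorphic map `ch : E → Φ` (e.g. `B ↦ (exp(iξB)·𝐔₀, 𝐉)` of the §3 analysis) sending a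
set `s` into the space `U^c_j(X, α_{0,j}, α_{1,j})`, the chart functional `B ↦ 𝐄^{(j)}(X, ch B, z)` is holomorphic on `s`
— the form in which (ii) is consumed by the Cauchy estimates behind the kernel bounds of (3.50) p. 280 (`B14.Eq350KernelCauchy`)
and the per-domain bounds of p. 283 (`B14Claim283RAnalytic`, hypothesis `hf`). [cite: Balaban1988Convergent, (2.27)(ii) p.259, (3.50) p.280] -/
theorem analyticOnNhd_E_chart (h : LFHypAnalytic T c k) {j : ℕ} (h1 : 1 ≤ j) (hj : j ≤ k) (X : (T.sys j).Dom)
    (z : T.Pt j) {g : ℝ} (hg0 : 0 ≤ g) (hgγ : g ≤ c.γ) {ch : E → Φ} {s : Set E} (hch : AnalyticOnNhd ℂ ch s)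
    (hmaps : MapsTo ch s (T.space j X (c.alpha0 (T.flow.g j)) (c.alpha1 (T.flow.g j)))) :
    AnalyticOnNhd ℂ (fun B => T.E j X z g (ch B)) s :=
  (h.analyticE j h1 hj X z g hg0 hgγ).comp hch hmaps

/-- The same for the 𝐑-terms ((2.30) (ii)). [cite: Balaban1988Convergent, (2.30) p.260] -/
theorem analyticOnNhd_R_chart (h : LFHypAnalytic T c k) {j : ℕ} (h1 : 1 ≤ j) (hj : j ≤ k) (X : (T.sys j).Dom)
    {ch : E → Φ} {s : Set E} (hch : AnalyticOnNhd ℂ ch s)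
    (hmaps : MapsTo ch s (T.space j X (c.alpha0 (T.flow.g j)) (c.alpha1 (T.flow.g j)))) :
    AnalyticOnNhd ℂ (fun B => T.R j X (ch B)) s :=
  (h.analyticR j h1 hj X).comp hch hmaps

/-- The same for the 𝐁-terms on `Ũ^c_j` ((2.41)(ii)). [cite: Balaban1988Convergent, (2.41)(ii) p.261] -/
theorem analyticOnNhd_B_chart (h : LFHypAnalytic T c k) {j : ℕ} (h1 : 1 ≤ j) (hj : j ≤ k) (X : (T.sys j).Dom)
    (a : 𝔄) {ch : E → Φ} {s : Set E} (hch : AnalyticOnNhd ℂ ch s) (hmaps : MapsTo ch s (T.spaceB j X)) :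
    AnalyticOnNhd ℂ (fun B => T.B j X (ch B) a) s :=
  (h.analyticB j h1 hj X a).comp hch hmaps

end LFHypAnalytic

section ChartBounds

variable {T : LFTower P G Φ 𝒢 𝔄} {c : LFConsts} {k : ℕ} {E : Type*}

/-- **(iv) in a chart**: with the same inclusion, the bound (I.1.18) `‖𝐄^{(j)}(X, ·, z)‖ ≤ E₀e^{−κd_j(X)}` of `LFHyp.boundE`
holds along the chart — the sup-bound hypothesis (`hS`-shape) of the Cauchy-estimate files. [cite: Balaban1988Convergent, (2.27)(iv) p.259] -/
theorem norm_E_chart_le (hH : LFHyp T c k) {j : ℕ} (h1 : 1 ≤ j) (hj : j ≤ k) (X : (T.sys j).Dom) (z : T.Pt j)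
    {g : ℝ} (hg0 : 0 ≤ g) (hgγ : g ≤ c.γ) {ch : E → Φ} {s : Set E}
    (hmaps : MapsTo ch s (T.space j X (c.alpha0 (T.flow.g j)) (c.alpha1 (T.flow.g j)))) {B : E} (hB : B ∈ s) :
    ‖T.E j X z g (ch B)‖ ≤ c.E₀ * Real.exp (-c.κ * (T.sys j).dj X) :=
  hH.boundE j h1 hj X z g (ch B) hg0 hgγ (hmaps hB)

/-- **(2.31) in a chart**: `‖𝐑^{(j)}(X, ch B)‖ ≤ g_j^{κ₀}e^{−κd_j(X)}` on `s` (the `hS` hypothesis of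
`B14Claim283RAnalytic.diff_chart_norm_le_coupling_of_analytic`, given the inclusion). [cite: Balaban1988Convergent, (2.31) p.260] -/
theorem norm_R_chart_le (hH : LFHyp T c k) {j : ℕ} (h1 : 1 ≤ j) (hj : j ≤ k) (X : (T.sys j).Dom)
    {ch : E → Φ} {s : Set E} (hmaps : MapsTo ch s (T.space j X (c.alpha0 (T.flow.g j)) (c.alpha1 (T.flow.g j))))
    {B : E} (hB : B ∈ s) :
    ‖T.R j X (ch B)‖ ≤ (T.flow.g j) ^ c.κ₀ * Real.exp (-c.κ * (T.sys j).dj X) :=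
  hH.boundR j h1 hj X (ch B) (hmaps hB)

end ChartBounds

/-! ## §3  The summation ranges of (2.26)–(2.27), (2.30), (2.41) WITH BODY on the ℤᵈ cube carrier -/

section Ranges

variable {d : ℕ}

/-- A REALISATION of the tower's abstract domain and point types inside the index lattice of `T_ξ` (pv02's carrier
`B14DomainGeom.Pt d = ℤᵈ`): the localization domain `X ∈ 𝐃_j` as a point set `pts j X` (print: *«unions of the MR_j-cubes
in the lattice T_ξ»*, p. 260) and the point `z ∈ T_1^{(j)}` by a representative lattice point `rep j z` (so that «X ∋ z»
reads `rep j z ∈ pts j X`). [cite: Balaban1988Convergent, (2.27) p.259, (2.30) p.260] -/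
structure Realisation (T : LFTower P G Φ 𝒢 𝔄) (d : ℕ) where
  pts : (j : ℕ) → (T.sys j).Dom → Set (Pt d)
  rep : (j : ℕ) → T.Pt j → Pt d

variable {T : LFTower P G Φ 𝒢 𝔄}

/-- **Λ_j⁰** (p. 259): *«the set which is obtained by removing one layer of the MR_j-cubes from Λ_j»* — on the cube carrier,
the points of `Λ_j` all of whose index-neighbours at cube side `sM j` lie in `Λ_j` (`B14DomainGeom.innerN (sM j) 1`).
[cite: Balaban1988Convergent, (2.26) p.259] -/
def Lambda0 (sM : ℕ → ℕ) (Λ : ℕ → Set (Pt d)) (j : ℕ) : Set (Pt d) := innerN (sM j) 1 (Λ j)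

/-- `Λ_j⁰ ⊆ Λ_j`. [cite: Balaban1988Convergent, (2.26) p.259] -/
theorem Lambda0_subset (sM : ℕ → ℕ) (Λ : ℕ → Set (Pt d)) (j : ℕ) : Lambda0 sM Λ j ⊆ Λ j :=
  innerN_subset _ _ _

open Classical in
/-- **The (2.26)–(2.27) range WITH BODY**: the index predicate of the 𝐄-part of (2.23)/(2.25) — `admE j X z` iff
*«z ∈ Λ_j⁰»* (2.26) and *«X ∋ z … X ∈ 𝐃_j contained in Λ_j, X ⊂ Λ_j»* (2.27). [cite: Balaban1988Convergent, (2.26)–(2.27) p.259] -/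
noncomputable def admE (ρ : Realisation T d) (sM : ℕ → ℕ) (Λ : ℕ → Set (Pt d)) (j : ℕ) (X : (T.sys j).Dom)
    (z : T.Pt j) : Bool :=
  if ρ.rep j z ∈ Lambda0 sM Λ j ∧ ρ.rep j z ∈ ρ.pts j X ∧ ρ.pts j X ⊆ Λ j then true else false

open Classical in
/-- **The (2.30) range WITH BODY**: `admR j X` iff *«X ∈ 𝐃_j contained in Λ_j^{∼−1}, X ⊂ Λ_j^{∼−1}»*, `Λ_j^{∼−1}` = `Λ_j`
minus one layer of MR_j-cubes = `innerN (sM j) 1 (Λ j)`. [cite: Balaban1988Convergent, (2.30) p.260] -/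
noncomputable def admR (ρ : Realisation T d) (sM : ℕ → ℕ) (Λ : ℕ → Set (Pt d)) (j : ℕ) (X : (T.sys j).Dom) : Bool :=
  if ρ.pts j X ⊆ innerN (sM j) 1 (Λ j) then true else false

open Classical in
/-- **The (2.41) range WITH BODY**: `admB j X` iff *«X ∈ 𝐃_j such, that X∩Ω_j ≠ ∅, and X∩Z_j^∼ ≠ ∅»*, with `Z_j = Λ_jᶜ`
((2.3); `= B14.Eq21Admissible.Z Λ j` of the (2.1)–(2.3) file, by `rfl`) and `Z_j^∼ = enl (sZ j) 1 Z_j` (one layer of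
cubes of side `sZ j` added). [cite: Balaban1988Convergent, (2.41) p.261, (2.3) p.255] -/
noncomputable def admB (ρ : Realisation T d) (sZ : ℕ → ℕ) (Ω Λ : ℕ → Set (Pt d)) (j : ℕ) (X : (T.sys j).Dom) :
    Bool :=
  if (ρ.pts j X ∩ Ω j).Nonempty ∧ (ρ.pts j X ∩ enl (sZ j) 1 (Λ j)ᶜ).Nonempty then true else false

variable (ρ : Realisation T d) (sM sZ : ℕ → ℕ) (Ω Λ : ℕ → Set (Pt d))

/-- `admE` unfolded. [cite: Balaban1988Convergent, (2.26)–(2.27) p.259] -/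
theorem admE_iff (j : ℕ) (X : (T.sys j).Dom) (z : T.Pt j) :
    admE ρ sM Λ j X z = true ↔ ρ.rep j z ∈ Lambda0 sM Λ j ∧ ρ.rep j z ∈ ρ.pts j X ∧ ρ.pts j X ⊆ Λ j := by
  unfold admE; split_ifs with h <;> simp [h]

/-- `admR` unfolded. [cite: Balaban1988Convergent, (2.30) p.260] -/
theorem admR_iff (j : ℕ) (X : (T.sys j).Dom) : admR ρ sM Λ j X = true ↔ ρ.pts j X ⊆ innerN (sM j) 1 (Λ j) := by
  unfold admR; split_ifs with h <;> simp [h]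

/-- `admB` unfolded. [cite: Balaban1988Convergent, (2.41) p.261] -/
theorem admB_iff (j : ℕ) (X : (T.sys j).Dom) :
    admB ρ sZ Ω Λ j X = true ↔
      (ρ.pts j X ∩ Ω j).Nonempty ∧ (ρ.pts j X ∩ enl (sZ j) 1 (Λ j)ᶜ).Nonempty := by
  unfold admB; split_ifs with h <;> simp [h]

/-- In the (2.26)–(2.27) range the point `z` lies in `Λ_j` (as `Λ_j⁰ ⊆ Λ_j`) and in `X`, and `X ⊆ Λ_j`. [cite: Balaban1988Convergent, (2.26)–(2.27) p.259] -/
theorem rep_mem_of_admE {j : ℕ} {X : (T.sys j).Dom} {z : T.Pt j} (h : admE ρ sM Λ j X z = true) :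
    ρ.rep j z ∈ Λ j ∧ ρ.rep j z ∈ ρ.pts j X ∧ ρ.pts j X ⊆ Λ j := by
  obtain ⟨h0, hz, hX⟩ := (admE_iff ρ sM Λ j X z).1 h
  exact ⟨Lambda0_subset sM Λ j h0, hz, hX⟩

/-- A domain of the (2.30) range lies in `Λ_j` itself. [cite: Balaban1988Convergent, (2.30) p.260] -/
theorem subset_of_admR {j : ℕ} {X : (T.sys j).Dom} (h : admR ρ sM Λ j X = true) : ρ.pts j X ⊆ Λ j :=
  ((admR_iff ρ sM Λ j X).1 h).trans (innerN_subset _ _ _)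

/-- … and so does its one-layer enlargement: `X ⊂ Λ_j^{∼−1} ⇒ X^∼ ⊂ Λ_j` (why the 𝐑-terms need no boundary bookkeeping).
[cite: Balaban1988Convergent, (2.30) p.260] -/
theorem enl_subset_of_admR {j : ℕ} {X : (T.sys j).Dom} (h : admR ρ sM Λ j X = true) :
    enl (sM j) 1 (ρ.pts j X) ⊆ Λ j := by
  intro x hx
  obtain ⟨y, hy, hxy⟩ := hx
  exact ((admR_iff ρ sM Λ j X).1 h hy).2 x hxy.symm

/-- **The 𝐑- and 𝐁-ranges are disjoint** (at equal cube sides for `Λ_j^{∼−1}` and `Z_j^∼`): a domain inside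
`Λ_j^{∼−1} = ((Λ_jᶜ)^∼)ᶜ` does not meet `Z_j^∼ = (Λ_jᶜ)^∼` — print's 𝐑-terms live away from the large-field regions, its
𝐁-terms *«localized closely to large field regions»* (p. 259). [cite: Balaban1988Convergent, (2.30) p.260, (2.41) p.261] -/
theorem admB_false_of_admR {j : ℕ} (hs : sZ j = sM j) {X : (T.sys j).Dom} (h : admR ρ sM Λ j X = true) :
    admB ρ sZ Ω Λ j X = false := by
  rw [Bool.eq_false_iff]
  intro hB
  obtain ⟨-, ⟨x, hxX, hxZ⟩⟩ := (admB_iff ρ sZ Ω Λ j X).1 hB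
  have hx : x ∈ innerN (sM j) 1 (Λ j) := (admR_iff ρ sM Λ j X).1 h hxX
  rw [innerN_eq_compl_enl_compl] at hx
  rw [hs] at hxZ
  exact hx hxZ

end Ranges

/-! ## §4  (2.26), (2.27), (2.30), (2.41) WITH BODY in print's nesting, and the four-family action -/

section Displays

variable {d : ℕ} {T : LFTower P G Φ 𝒢 𝔄} (ρ : Realisation T d) (sM sZ : ℕ → ℕ) (Ω Λ : ℕ → Set (Pt d))

open Classical in
/-- **(2.27) WITH BODY**: `𝐄^{(j)}(Λ_j, φ, z) := Σ_{X ∋ z, X ∈ 𝐃_j, X ⊂ Λ_j} 𝐄^{(j)}(X, φ, z)` (at coupling `g`).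
[cite: Balaban1988Convergent, (2.27) p.259] -/
noncomputable def E227 (j : ℕ) (z : T.Pt j) (g : ℝ) (φ : Φ) : ℂ :=
  ∑ X : (T.sys j).Dom, if ρ.rep j z ∈ ρ.pts j X ∧ ρ.pts j X ⊆ Λ j then T.E j X z g φ else 0

open Classical in
/-- **(2.26) WITH BODY**: `𝐄^{(j)}(Λ_j, φ) := Σ_{z ∈ Λ_j⁰} 𝐄^{(j)}(Λ_j, φ, z)`. [cite: Balaban1988Convergent, (2.26) p.259] -/
noncomputable def E226 (j : ℕ) (g : ℝ) (φ : Φ) : ℂ :=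
  ∑ z : T.Pt j, if ρ.rep j z ∈ Lambda0 sM Λ j then E227 ρ Λ j z g φ else 0

open Classical in
/-- **(2.30)'s localized sum WITH BODY**: `𝐑^{(j)}(Λ_j, φ) := Σ_{X ∈ 𝐃_j, X ⊂ Λ_j^{∼−1}} 𝐑^{(j)}(X, φ)` («the localized
renormalization of the form (I.1.7), but with the summation over localization domains … contained in Λ_j^{∼−1}»).
[cite: Balaban1988Convergent, (2.30) p.260] -/
noncomputable def RLoc (j : ℕ) (φ : Φ) : ℂ :=
  ∑ X : (T.sys j).Dom, if admR ρ sM Λ j X then T.R j X φ else 0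

open Classical in
/-- **(2.41) WITH BODY**: `𝐁^{(j)}(φ, a) := Σ_{X ∈ 𝐃_j, X∩Ω_j ≠ ∅, X∩Z_j^∼ ≠ ∅} 𝐁^{(j)}(X, φ, a)`. [cite: Balaban1988Convergent, (2.41) p.261] -/
noncomputable def B241 (j : ℕ) (φ : Φ) (a : 𝔄) : ℂ :=
  ∑ X : (T.sys j).Dom, if admB ρ sZ Ω Λ j X then T.B j X φ a else 0

open Classical in
/-- `Λ_j⁰` as the finite set of points `z ∈ T_1^{(j)}` (those whose representative lies in `Lambda0`), the index set of the sum
(2.26). [cite: Balaban1988Convergent, (2.26) p.259] -/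
noncomputable def ptsLambda0 (j : ℕ) : Finset (T.Pt j) := Finset.univ.filter fun z => ρ.rep j z ∈ Lambda0 sM Λ j

/-- (2.26) IS the `Eq226` predicate of `B14.Eq364Beta` (the form differentiated twice there to obtain (3.63)) for the bodies
above, with the index set `ptsLambda0` = Λ_j⁰, read on the real parts at any fixed coupling. [cite: Balaban1988Convergent, (2.26) p.259] -/
theorem eq226_E226 (j : ℕ) (g : ℝ) :
    B14.Eq364Beta.Eq226 (fun φ : Φ => (E226 ρ sM Λ j g φ).re) (fun z φ => (E227 ρ Λ j z g φ).re)
      (ptsLambda0 ρ sM Λ j) := by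
  classical
  intro φ
  show (E226 ρ sM Λ j g φ).re = ∑ z ∈ ptsLambda0 ρ sM Λ j, (E227 ρ Λ j z g φ).re
  rw [E226, Complex.re_sum, ptsLambda0, Finset.sum_filter]
  refine Finset.sum_congr rfl fun z _ => ?_
  split_ifs <;> simp

/-- The pre-cell 𝐄-summand of (2.23)/(2.25) (`Step.LFActionData.action23`: `Σ_X Σ_z [admE] (Re 𝐄(X,U,z) − Re 𝐄(X,1,z))`)
over the REALISED range is print's (2.26)∘(2.27) double sum: `= Re 𝐄^{(j)}(Λ_j, U) − Re 𝐄^{(j)}(Λ_j, 1)` (the two nestings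
agree by `Finset.sum_comm`). [cite: Balaban1988Convergent, (2.25)–(2.27) p.259] -/
theorem Esum_eq (j : ℕ) (g : ℝ) (φ ψ : Φ) :
    (∑ X : (T.sys j).Dom, ∑ z : T.Pt j,
        if admE ρ sM Λ j X z then ((T.E j X z g φ).re - (T.E j X z g ψ).re) else 0)
      = (E226 ρ sM Λ j g φ).re - (E226 ρ sM Λ j g ψ).re := by
  classical
  have key : ∀ χ : Φ, (∑ X : (T.sys j).Dom, ∑ z : T.Pt j,
      (if admE ρ sM Λ j X z = true then (T.E j X z g χ).re else 0)) = (E226 ρ sM Λ j g χ).re := by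
    intro χ
    rw [Finset.sum_comm, E226, Complex.re_sum]
    refine Finset.sum_congr rfl fun z _ => ?_
    by_cases hz : ρ.rep j z ∈ Lambda0 sM Λ j
    · rw [if_pos hz, E227, Complex.re_sum]
      refine Finset.sum_congr rfl fun X _ => ?_
      by_cases hX : ρ.rep j z ∈ ρ.pts j X ∧ ρ.pts j X ⊆ Λ j
      · rw [if_pos hX, if_pos ((admE_iff ρ sM Λ j X z).2 ⟨hz, hX⟩)]
      · rw [if_neg hX, if_neg (fun h => hX ((admE_iff ρ sM Λ j X z).1 h).2), Complex.zero_re]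
    · rw [if_neg hz, Complex.zero_re]
      refine Finset.sum_eq_zero fun X _ => ?_
      rw [if_neg (fun h => hz ((admE_iff ρ sM Λ j X z).1 h).1)]
  rw [← key, ← key, ← Finset.sum_sub_distrib]
  refine Finset.sum_congr rfl fun X _ => ?_
  rw [← Finset.sum_sub_distrib]
  refine Finset.sum_congr rfl fun z _ => ?_
  split_ifs <;> simp

/-- The pre-cell 𝐑-summand of (2.23) over the realised range is **(2.30)'s** `Re 𝐑^{(j)}(Λ_j, U) − Re 𝐑^{(j)}(Λ_j, 1)`, each
`𝐑^{(j)}(Λ_j, ·)` the localized sum over `X ⊂ Λ_j^{∼−1}`. [cite: Balaban1988Convergent, (2.30) p.260] -/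
theorem Rsum_eq (j : ℕ) (φ ψ : Φ) :
    (∑ X : (T.sys j).Dom, if admR ρ sM Λ j X then ((T.R j X φ).re - (T.R j X ψ).re) else 0)
      = (RLoc ρ sM Λ j φ).re - (RLoc ρ sM Λ j ψ).re := by
  classical
  rw [RLoc, RLoc, Complex.re_sum, Complex.re_sum, ← Finset.sum_sub_distrib]
  refine Finset.sum_congr rfl fun X _ => ?_
  split_ifs <;> simp

/-- The pre-cell 𝐁-summand of (2.23) over the realised range is **(2.41)'s** `Re 𝐁^{(j)}(U, A, {S_i})`.
[cite: Balaban1988Convergent, (2.40)–(2.41) p.261] -/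
theorem Bsum_eq (j : ℕ) (φ : Φ) (a : 𝔄) :
    (∑ X : (T.sys j).Dom, if admB ρ sZ Ω Λ j X then (T.B j X φ a).re else 0) = (B241 ρ sZ Ω Λ j φ a).re := by
  classical
  rw [B241, Complex.re_sum]
  refine Finset.sum_congr rfl fun X _ => ?_
  split_ifs <;> simp

end Displays

/-! ## §5  (2.23) with the realised ranges: every localized part WITH BODY -/

section Action

variable {d : ℕ} {T : LFTower P G Φ 𝒢 𝔄} (ρ : Realisation T d) (sM sZ : ℕ → ℕ) (Ω Λ : ℕ → Set (Pt d))

/-- THE REALISED ACTION DATA: any pre-cell action record `D : Step.LFActionData` (its smeared Wilson actions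
`A(1/g_k²(·), ·)`, `A(φ_j, ·)` — WITH BODY in `B14.Eq225Concrete.concrete` —, its fluctuation/`S`-data and `E_k`) with the
three index predicates REPLACED by the (2.26)–(2.27) / (2.30) / (2.41) ranges WITH BODY of §3. [cite: Balaban1988Convergent, (2.23)–(2.41) pp.258–261] -/
noncomputable def realise (D : LFActionData P G T) : LFActionData P G T :=
  { D with admE := admE ρ sM Λ, admR := admR ρ sM Λ, admB := admB ρ sZ Ω Λ }

/-- **(2.23) with (2.25), (2.26)–(2.27), (2.30), (2.40)–(2.41) ALL WITH BODY** (print's nesting):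
`A_k(1/g_k², U) = −A(1/g_k²(·), U) + Σ_{j=1}^{k} [Re 𝐄^{(j)}(Λ_j, U) − Re 𝐄^{(j)}(Λ_j, 1) − β_j(g_{j−1})A(φ_j, U)]`
`+ Σ_{j=1}^{k} [Re 𝐑^{(j)}(Λ_j, U) − Re 𝐑^{(j)}(Λ_j, 1)] + Σ_{j=1}^{k} Re 𝐁^{(j)}(U, A, {S_i}) − E_k`, the extended terms read AT
`T.ofBackground U` = (U, J(U)) as (I.1.9) prescribes. [cite: Balaban1988Convergent, (2.23) p.258, (2.25)–(2.27) p.259, (2.30) p.260, (2.40)–(2.41) p.261] -/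
theorem action23_realise (D : LFActionData P G T) (k : ℕ) (U : GaugeField P 0 G) :
    (realise ρ sM sZ Ω Λ D).action23 k U =
      - D.wilsonLocal U
      + ∑ j ∈ Icc 1 k, ((E226 ρ sM Λ j (T.flow.g (j - 1)) (T.ofBackground U)).re
          - (E226 ρ sM Λ j (T.flow.g (j - 1)) (T.ofBackground 1)).re
          - T.flow.β j (T.flow.g (j - 1)) * D.wilsonPhi j U)
      + ∑ j ∈ Icc 1 k, ((RLoc ρ sM Λ j (T.ofBackground U)).re - (RLoc ρ sM Λ j (T.ofBackground 1)).re)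
      + ∑ j ∈ Icc 1 k, (B241 ρ sZ Ω Λ j (T.ofBackground U) D.fluct).re - D.Econst := by
  have h0 : (realise ρ sM sZ Ω Λ D).action23 k U =
      - D.wilsonLocal U
      + ∑ j ∈ Icc 1 k, ((∑ X : (T.sys j).Dom, ∑ z : T.Pt j,
            if admE ρ sM Λ j X z then ((T.E j X z (T.flow.g (j - 1)) (T.ofBackground U)).re
              - (T.E j X z (T.flow.g (j - 1)) (T.ofBackground 1)).re) else 0)
          - T.flow.β j (T.flow.g (j - 1)) * D.wilsonPhi j U)
      + ∑ j ∈ Icc 1 k, ∑ X : (T.sys j).Dom,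
          (if admR ρ sM Λ j X then ((T.R j X (T.ofBackground U)).re - (T.R j X (T.ofBackground 1)).re) else 0)
      + ∑ j ∈ Icc 1 k, ∑ X : (T.sys j).Dom,
          (if admB ρ sZ Ω Λ j X then (T.B j X (T.ofBackground U) D.fluct).re else 0)
      - D.Econst := rfl
  rw [h0]
  congr 1; congr 1
  · congr 1
    · congr 1
      exact Finset.sum_congr rfl fun j _ => by rw [Esum_eq]
    · exact Finset.sum_congr rfl fun j _ => by rw [Rsum_eq]
  · exact Finset.sum_congr rfl fun j _ => by rw [Bsum_eq]

end Action

end Literature.MathematicalPhysics.QuantumFieldTheory.Balaban1983to89.B14.Eq227LocalizedTerms
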